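import Summits.QuantumFields.YangMills.Theorems.BalabanUVNodesK1V7RDefs

/-!
# K1⁸ (Variant Rʳ, v7ᴿ ed.2) — THE CEILING-KEYED RUNG-1 BRIDGES INTO RUNG 2‴ AND THE MATCH-FREE ∃-SIDE PRODUCERS OF `StabilityBRunRowsAtRecordR13SepCoPH` BY NAME

Cell `pub-ymgap`, WIDTH SEAT `pub-ymgap-dag-n24-w1` (gen 4; director-ym №197 ∕ HUMAN RULING D-0149).  `--kind proof --supports stmt-QuantumFields-26907 --as helper` (count-neutral).
Second module of this generation, on top of this seat's `Thm/BalabanUVNodesK1V7RDefs.lean` (p617892 ✓, 2026-08-28T08:40Z: the registered v7ᴿ stub-3 text `RunRowsContAtSomeRecord13PWS` BY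
NAME, the K1⁸ composition, the witness adapters) and this seat's `Thm/BalabanUVNodesK1RunRowsOfBoxAndPartialSums.lean` §3 (gen 2, p602861 ✓: the CEILING-KEYED rung-1 bridge into K1 v6's
rung 2″ — «the match discharged by choosing the world after the rows»).
[I] = [Balaban1987RG1]; [II] = [Balaban1988RG2Cluster]; [III] = [Balaban1988Convergent]; [V] = [Balaban1989LargeFieldII].

WHY.  The registered β-side stub texts of K1 v7ᴿ (`stub_runRows13PWS`, `stub_cont13`; plan g84, skeleton d90044cd05ffffb9 on K1⁸ stmt-QuantumFields-26907) carry the numeric CEILING MATCH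
`B + r ≤ w.βup` against the world `w` of the rung-1 witness — N11's `flowControl` reads `w.βup` — while the thirteen nodes are ANTITONE in `w.βup` (CRIT-1 g4 K1NEGCTL; Negative p602267:
a ceiling letter quantified over ALL rung-1 witnesses is inconsistent with one).  The live MATCH-FREE shape (plan g82 WORDS-2 (B) «welcome as a TREE bridge»; START-LIST §1 MATCHʳ; CRIT-1's
`N11CU` = [III] Thm 1 with `β′` a parameter, CMP 119 p.255 L28–31) is the CEILING-KEYED rung 1 at ONE tuple: `∀ c, ∃ w, c ≤ w.βup ∧ RecordS F θ h w ∧ ∀ P, Nodes (leavesP w P)` — the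
world keyed AFTER the ceiling.  p602861 §3 turned «ceiling-keyed rung 1 + match-free rows» into v6's rung-2″ text; THIS FILE does the same for v7ᴿ's rung 2‴ (rows + (C); the level-matching
free by `K1V7RDefs.runRowsContAt_of_runRowsAt_of_survCont`, dag-n17-w1's `survCont_anti`) and draws the consequence for the closing shape: on ym-nodeO DEF-1's 2ᴮ″ currency the numeric
match of the displayed adapter DISAPPEARS — «ceiling-keyed rung 1 + ONE run letter `RunRemAt F κ θ h c` + the bare drift» ⊢ rung 2‴, hence K1⁸ BY NAME from ONE ∃-side producer whose β-side
input is EXACTLY K2⁷'s 2ᴮ″ pair at the K1 tuple (`stabilityBRunRowsAtRecordR13SepCoPH_of_ceilingKeyedRung1WithRunRemAt`).  Whether the rung-1 lanes CAN export ceiling-keyed worlds is their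
question (N11 with `β′` a parameter; dag-n12-d ANSWER-CEILING; dag-n24-c's world-builders take the requested ceiling as an input) — NOT claimed here.

CONTENTS.  §1 `runRowsContAt_of_ceilingKeyedRung1_of_rows_of_survCont` (ceiling-keyed rung 1 + match-free bounded rows + (C) at any level ⟹ rung 2‴) ·
`runRowsContAt_of_ceilingKeyedRung1_of_runRemAt_drift` (… + `RunRemAt` + drift, NO match) · `runRowsContAt_of_ceilingKeyedRung1_of_remAt_drift` (ed.3's box letter) ·
`runRowsContAt_of_ceilingKeyedRung1_of_rows_of_cont13All` ((C) from DEF-1's ∀θ letter, read at the presenting tuple).  §2 ★ `stabilityBRunRowsAtRecordR13SepCoPH_of_ceilingKeyedRung1WithRunRemAt` ·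
`stabilityBRunRowsAtRecordR13SepCoPH_of_ceilingKeyedRung1WithBoundedRowsCont` · `stabilityBRunRowsAtRecordR13SepCoPH_of_ceilingKeyedRung1WithBoundedRows_of_cont13All` (the route decl K1⁸
BY NAME from ONE ∃-side producer each; the TYPE is the route decl literally).

HONEST FRAMING.  By-name glue over displayed hypothesis shapes; NOTHING of Bałaban asserted; NO stub proved; the ceiling-keyed rung 1 is a HYPOTHESIS SHAPE (not supplied here); K0⁷
stmt-QuantumFields-20541 ∕ K1⁸ stmt-QuantumFields-26907 ∕ K3⁷ stmt-QuantumFields-20544 OPEN; N24 COMPOSITE.  Counts unmoved (typed 28∕28 · discharged 5∕27 (A 5∕28)).  [I] §1 continuity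
and [B12] Thm 2 unproved in print.  One finite 𝕋⁴ programme at fixed `ε = L^{−K}`, Bałaban AS PRINTED — NOT continuum ∕ ℝ⁴ ∕ OS ∕ mass gap ∕ Clay: the Yang–Mills mass gap is NOT proved by
any of this; route R4 closes the CONDITIONAL finite-𝕋⁴ rung `BalabanLadder.UV` only.  No `sorry`, `instance`, `notation`; standard axioms.
-/

noncomputable section

open scoped Matrix.Norms.L2Operator

namespace Summit.QuantumFields.YangMills.Theorems.K1R8OfCeilingKeyedRung1

open Literature.MathematicalPhysics.QuantumFieldTheory.Balaban1983to89
open Literature.MathematicalPhysics.QuantumFieldTheory.Balaban1983to89.T4Continuum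
open Literature.MathematicalPhysics.QuantumFieldTheory.Balaban1983to89.DagBinding
open FlowStepRuns
open FlowStep (HBeta RGEqH prefixOf BetaContH)
open Summit.QuantumFields.YangMills.Theorems.BalabanUVNodesK2NamedJetsRunRemAt (RunRemAt RunConstRemainder SurvCont runwisePS_of_drift_runConstRemainder runRemAt_of_remAt)
open Summit.QuantumFields.YangMills.Theorems.BalabanUVNodesK2NamedJetsRemAt (RemAt band_of_drift)
open Summit.QuantumFields.YangMills.Theorems.BalabanUVNodesK2JsOfRecord (StepColourData beta0OfJs)
open Literature.MathematicalPhysics.QuantumFieldTheory.Balaban1983to89.Beta.Drift (OneLoopDrift)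
open Summit.QuantumFields.YangMills.Theorems.EndpointGivenBR13SepCoPH.Negative.RemNamedJets13FalseOfTwoNormalisations (oneLoopDrift_const_mul)
open Summit.QuantumFields.YangMills.Theorems.K1V6Defs (RecordS Inhabited13 NodesAtSomeRecord13PWS RunRowsAtSomeRecord13PWS)
open Summit.QuantumFields.YangMills.Theorems.BalabanUVNodesK1R8RowsDefs (RunRowsCont13 Cont13All)
open Summit.QuantumFields.YangMills.Theorems.K1V7RDefs (RunRowsContAtSomeRecord13PWS runRowsContAt_of_runRowsAt_of_survCont
  stabilityBRunRowsAtRecordR13SepCoPH_of_rung0_runRowsCont)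

/-! ## §1 The ceiling-keyed rung-1 bridges into rung 2‴ (p602861 §3 read with (C)) -/

section CeilingKeyed

variable {F : T4Family}

/-- **★ THE CEILING-KEYED BRIDGE INTO v7ᴿ's RUNG 2‴** (this seat's p602861 `K1RunRowsOfBoxAndPartialSums.runRowsText_of_ceilingKeyedRung1_of_rows` read with a continuity letter): from
the CEILING-KEYED rung-1 data at one unity tuple `(θ, h)` — for EVERY requested ceiling `c` an S-bound world `w` of the datum with `c ≤ w.βup` and the thirteen nodes at every run (N11 with
`β′` a parameter, [III] Thm 1 p.262 with p.255 L28–31; CRIT-1's `N11CU`; the world keyed AFTER the ceiling, the K1NEGCTL-consistent form) — and the MATCH-FREE rows of `β_θ` (run-wise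
constant remainder relative to a reference `b ≤ B`, run-wise (PS) floor; NO ceiling clause) plus (C) `SurvCont β_θ γc` at ANY level: rung 2‴, the world chosen at `c := B + r`, the level
`min γ₀ γc` (`K1V7RDefs.runRowsContAt_of_runRowsAt_of_survCont`).  Whether rung-1 worlds ARE ceiling-keyed is the rung-1 lanes' question, NOT claimed.  CONDITIONAL; closes nothing.
[cite: Balaban1988Convergent, Thm 1 p.262, p.255, (2.6) p.255; Balaban1987RG1, Thm 3 p.264, (1.20)–(1.22) p.264, §1 pp.263–264; Balaban1989LargeFieldII, Thm 1 p.355 (bookkeeping)] -/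
theorem runRowsContAt_of_ceilingKeyedRung1_of_rows_of_survCont (θ : Node00.Stage13HParams F 2) (h : θ.Provisos₁₃SepCoPH F 2)
    (hU : θ.ZhUnity F 2 ∧ θ.SlotsNondegenerate₁₃ F 2) (hθ : θ.Admissible F 2)
    (hfam : ∀ c : ℝ, ∃ w : WorldP, c ≤ w.βup ∧ RecordS F θ h w ∧ ∀ P : B12.RunParams, Nodes (leavesP w P))
    {b : ℕ → ℝ} {r γ₀ B M : ℝ} (hγ₀ : 0 < γ₀) (hrem : RunConstRemainder (Node00.betaOfRecord₁₃ F 2 θ.toStage13Params) b r γ₀) (hB : ∀ k, b k ≤ B)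
    (hps : ∀ (n : ℕ) (gs : ℕ → ℝ), RGEqH n (Node00.betaOfRecord₁₃ F 2 θ.toStage13Params) gs → Step.InInterval γ₀ n gs →
      ∀ k, k ≤ n → -M ≤ ∑ j ∈ Finset.Ico k n, Node00.betaOfRecord₁₃ F 2 θ.toStage13Params j (prefixOf gs j))
    {γc : ℝ} (hγc : 0 < γc) (hsc : SurvCont (Node00.betaOfRecord₁₃ F 2 θ.toStage13Params) γc) : RunRowsContAtSomeRecord13PWS F := by
  obtain ⟨w, hc, hR, hnodes⟩ := hfam (B + r)
  exact runRowsContAt_of_runRowsAt_of_survCont θ h w hU hθ hR hnodes hγ₀ hrem hB hc hps hγc hsc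

/-- **THE CEILING-KEYED BRIDGE ON THE 2ᴮ″ CURRENCY — NO MATCH LETTER AT ALL**: ceiling-keyed rung-1 data at `(θ, h)` + ONE run letter `RunRemAt F κ θ h c` (ym-nodeO DEF-1, p596574) + the
bare drift `OneLoopDrift (stepBal 2 F.L) A (beta0OfJs F κ)` ⊢ rung 2‴: the band `c·b_k ≤ c·stepBal 2 F.L + 2|c|A` (`band_of_drift` ∘ `oneLoopDrift_const_mul`), the run-wise (PS) with
`M := 2|c|A` (`runwisePS_of_drift_runConstRemainder`, cap `s ≤ c·stepBal 2 F.L`), (C) = the letter's own `SurvCont` conjunct, and the world requested at the ceiling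
`c·stepBal 2 F.L + 2|c|A + s` — so the numeric match of v6∕v7ᴿ's displayed adapter is DISCHARGED by the family's clause.  CONDITIONAL; closes nothing.
[cite: Balaban1987RG1, Thm 3 p.264, (1.20)–(1.22) p.264, (2.12)–(2.14) p.268, (5.10) p.293, §1 pp.263–264; Balaban1988Convergent, Thm 1 p.262, p.255 (bookkeeping)] -/
theorem runRowsContAt_of_ceilingKeyedRung1_of_runRemAt_drift (θ : Node00.Stage13HParams F 2) (h : θ.Provisos₁₃SepCoPH F 2)
    (hU : θ.ZhUnity F 2 ∧ θ.SlotsNondegenerate₁₃ F 2) (hθ : θ.Admissible F 2)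
    (hfam : ∀ c : ℝ, ∃ w : WorldP, c ≤ w.βup ∧ RecordS F θ h w ∧ ∀ P : B12.RunParams, Nodes (leavesP w P))
    (κ : StepColourData) {c A : ℝ} (hRun : RunRemAt F κ θ h c) (hdrift : OneLoopDrift (B12Normalization.stepBal 2 F.L) A (beta0OfJs F κ)) :
    RunRowsContAtSomeRecord13PWS F := by
  obtain ⟨γ₀, s, hγ₀, -, hcap, hrem, -, hsc⟩ := hRun
  have hd := oneLoopDrift_const_mul hdrift c
  have hband : ∀ k, c * beta0OfJs F κ k ≤ c * B12Normalization.stepBal 2 F.L + 2 * (|c| * A) := fun k => by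
    have := (abs_le.mp (band_of_drift hd k)).2
    linarith
  exact runRowsContAt_of_ceilingKeyedRung1_of_rows_of_survCont θ h hU hθ hfam hγ₀ hrem hband (runwisePS_of_drift_runConstRemainder hd hrem hcap) hγ₀ hsc

/-- … and on ed.3's BOX currency `RemAt F κ θ h c` (p593586), through DEF-1's `runRemAt_of_remAt`.  CONDITIONAL; closes nothing.
[cite: Balaban1987RG1, (1.20)–(1.22) p.264, (2.12)–(2.14) p.268, §1 pp.263–264 (bookkeeping)] -/
theorem runRowsContAt_of_ceilingKeyedRung1_of_remAt_drift (θ : Node00.Stage13HParams F 2) (h : θ.Provisos₁₃SepCoPH F 2)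
    (hU : θ.ZhUnity F 2 ∧ θ.SlotsNondegenerate₁₃ F 2) (hθ : θ.Admissible F 2)
    (hfam : ∀ c : ℝ, ∃ w : WorldP, c ≤ w.βup ∧ RecordS F θ h w ∧ ∀ P : B12.RunParams, Nodes (leavesP w P))
    (κ : StepColourData) {c A : ℝ} (hRem : RemAt F κ θ h c) (hdrift : OneLoopDrift (B12Normalization.stepBal 2 F.L) A (beta0OfJs F κ)) :
    RunRowsContAtSomeRecord13PWS F :=
  runRowsContAt_of_ceilingKeyedRung1_of_runRemAt_drift θ h hU hθ hfam κ (runRemAt_of_remAt F κ θ h hRem) hdrift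

/-- **(C) FROM DEF-1's ∀θ LETTER on the ceiling-keyed road**: `Cont13All` read at the PRESENTING tuple of the world the family returns (same datum ⟹ same β of record) — so
«ceiling-keyed rung 1 + match-free rows + `Cont13All`» ⊢ rung 2‴.  CONDITIONAL; closes nothing. [cite: Balaban1987RG1, §1 pp.263–264, Thm 3 p.264; Balaban1988Convergent, Thm 1 p.262 (bookkeeping)] -/
theorem runRowsContAt_of_ceilingKeyedRung1_of_rows_of_cont13All (hC : Cont13All) (θ : Node00.Stage13HParams F 2) (h : θ.Provisos₁₃SepCoPH F 2)
    (hU : θ.ZhUnity F 2 ∧ θ.SlotsNondegenerate₁₃ F 2) (hθ : θ.Admissible F 2)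
    (hfam : ∀ c : ℝ, ∃ w : WorldP, c ≤ w.βup ∧ RecordS F θ h w ∧ ∀ P : B12.RunParams, Nodes (leavesP w P))
    {b : ℕ → ℝ} {r γ₀ B M : ℝ} (hγ₀ : 0 < γ₀) (hrem : RunConstRemainder (Node00.betaOfRecord₁₃ F 2 θ.toStage13Params) b r γ₀) (hB : ∀ k, b k ≤ B)
    (hps : ∀ (n : ℕ) (gs : ℕ → ℝ), RGEqH n (Node00.betaOfRecord₁₃ F 2 θ.toStage13Params) gs → Step.InInterval γ₀ n gs →
      ∀ k, k ≤ n → -M ≤ ∑ j ∈ Finset.Ico k n, Node00.betaOfRecord₁₃ F 2 θ.toStage13Params j (prefixOf gs j)) :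
    RunRowsContAtSomeRecord13PWS F := by
  obtain ⟨w, hc, hR, hnodes⟩ := hfam (B + r)
  obtain ⟨θ', h', hθ'adm, hD, hC', ⟨hwγ, hwγle⟩, hL, hup⟩ := hR
  have hβ : Node00.betaOfRecord₁₃ F 2 θ'.toStage13Params = Node00.betaOfRecord₁₃ F 2 θ.toStage13Params := by
    have := congrArg (fun D => D.βfun) hD
    simpa [Node00.βfun_datumOfRecord₁₃SepCoPH] using this.symm
  have hsc : SurvCont (Node00.betaOfRecord₁₃ F 2 θ.toStage13Params) w.γ := by
    have := hC F θ' h' hθ'adm w.γ hwγ hwγle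
    rwa [hβ] at this
  exact runRowsContAt_of_runRowsAt_of_survCont θ h w hU hθ ⟨θ', h', hθ'adm, hD, hC', ⟨hwγ, hwγle⟩, hL, hup⟩ hnodes hγ₀ hrem hB hc hps hwγ hsc

end CeilingKeyed

/-! ## §2 The MATCH-FREE ∃-side producers of K1⁸ BY NAME -/

section Producers

/-- **★★ K1⁸ stmt-QuantumFields-26907 BY NAME, MATCH-FREE, ON THE 2ᴮ″ CURRENCY**: for every family with a unity Stage-13 tuple (K0⁷'s conclusion), SOME unity tuple `θ` with provisos
carries (a) a CEILING-KEYED family of S-bound worlds of its datum with the thirteen nodes at every run (`∀ c, ∃ w, c ≤ w.βup ∧ RecordS F θ h w ∧ ∀ P, Nodes (leavesP w P)` — the rung-1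
lanes' export with N11's `β′` a parameter) and (b) at SOME scale `c` and colour datum `κ` ym-nodeO DEF-1's run letter `RunRemAt F κ θ h c` with the bare drift of the named numbers.
Conclusion: `…Theses.BalabanUVNodes.StabilityBRunRowsAtRecordR13SepCoPH` (the TYPE is the route decl literally).  Compared with `K1V7RDefs.stabilityBRunRowsAtRecordR13SepCoPH_of_rung1WithRunRemAt`
the numeric match `2c·stepBal 2 F.L + 2|c|A ≤ w.βup` is GONE — paid by the family's clause; so on this road K1⁸'s β-side input is EXACTLY K2⁷'s 2ᴮ″ pair «run letter + drift» at the
K1 tuple.  CONDITIONAL on `h`; K1⁸ NOT closed by this theorem; nothing of Bałaban asserted; no count moved.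
[cite: Balaban1989LargeFieldII, Thm 1 p.355 + (0.1) pp.355–356 + p.391; Balaban1988Convergent, Thm 1 p.262, p.255, (2.6) p.255, Cor. 3 (2.50) p.264; Balaban1987RG1, Thm 2 p.259, Thm 3 p.264, (1.20)–(1.22) p.264, (2.12)–(2.14) p.268, (5.10) p.293, §1 pp.263–264 (bookkeeping)] -/
theorem stabilityBRunRowsAtRecordR13SepCoPH_of_ceilingKeyedRung1WithRunRemAt
    (h : ∀ F : T4Family, Inhabited13 F →
      ∃ (θ : Node00.Stage13HParams F 2) (h : θ.Provisos₁₃SepCoPH F 2), (θ.ZhUnity F 2 ∧ θ.SlotsNondegenerate₁₃ F 2) ∧ θ.Admissible F 2 ∧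
        (∀ c : ℝ, ∃ w : WorldP, c ≤ w.βup ∧ RecordS F θ h w ∧ ∀ P : B12.RunParams, Nodes (leavesP w P)) ∧
        ∃ (κ : StepColourData) (c A : ℝ), RunRemAt F κ θ h c ∧ OneLoopDrift (B12Normalization.stepBal 2 F.L) A (beta0OfJs F κ)) :
    Summit.QuantumFields.YangMills.Theses.BalabanUVNodes.StabilityBRunRowsAtRecordR13SepCoPH :=
  stabilityBRunRowsAtRecordR13SepCoPH_of_rung0_runRowsCont fun F hinh => by
    obtain ⟨θ, hP, hU, hθ, hfam, κ, c, A, hRun, hdrift⟩ := h F hinh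
    exact runRowsContAt_of_ceilingKeyedRung1_of_runRemAt_drift θ hP hU hθ hfam κ hRun hdrift

/-- **K1⁸ BY NAME, MATCH-FREE, ON THE GENERIC ROWS CURRENCY**: ceiling-keyed rung 1 at `(θ, h)` + the match-free BOUNDED rows of `β_θ` (DEF-1's per-tuple `RunRowsCont13 F θ` shape
with the reference bounded above, `∀ k, b k ≤ B`) — rows (i)(iv) and (C) on ONE level.  CONDITIONAL on `h`; K1⁸ NOT closed by this theorem.
[cite: Balaban1989LargeFieldII, Thm 1 p.355; Balaban1988Convergent, Thm 1 p.262, (2.6) p.255; Balaban1987RG1, Thm 3 p.264, (5.10) p.293, §1 pp.263–264 (bookkeeping)] -/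
theorem stabilityBRunRowsAtRecordR13SepCoPH_of_ceilingKeyedRung1WithBoundedRowsCont
    (h : ∀ F : T4Family, Inhabited13 F →
      ∃ (θ : Node00.Stage13HParams F 2) (h : θ.Provisos₁₃SepCoPH F 2), (θ.ZhUnity F 2 ∧ θ.SlotsNondegenerate₁₃ F 2) ∧ θ.Admissible F 2 ∧
        (∀ c : ℝ, ∃ w : WorldP, c ≤ w.βup ∧ RecordS F θ h w ∧ ∀ P : B12.RunParams, Nodes (leavesP w P)) ∧
        ∃ (b : ℕ → ℝ) (r γ₀ B M : ℝ), 0 < γ₀ ∧ RunConstRemainder (Node00.betaOfRecord₁₃ F 2 θ.toStage13Params) b r γ₀ ∧ (∀ k, b k ≤ B) ∧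
          (∀ (n : ℕ) (gs : ℕ → ℝ), RGEqH n (Node00.betaOfRecord₁₃ F 2 θ.toStage13Params) gs → Step.InInterval γ₀ n gs →
            ∀ k, k ≤ n → -M ≤ ∑ j ∈ Finset.Ico k n, Node00.betaOfRecord₁₃ F 2 θ.toStage13Params j (prefixOf gs j)) ∧
          SurvCont (Node00.betaOfRecord₁₃ F 2 θ.toStage13Params) γ₀) :
    Summit.QuantumFields.YangMills.Theses.BalabanUVNodes.StabilityBRunRowsAtRecordR13SepCoPH :=
  stabilityBRunRowsAtRecordR13SepCoPH_of_rung0_runRowsCont fun F hinh => by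
    obtain ⟨θ, hP, hU, hθ, hfam, b, r, γ₀, B, M, hγ₀, hrem, hB, hps, hsc⟩ := h F hinh
    exact runRowsContAt_of_ceilingKeyedRung1_of_rows_of_survCont θ hP hU hθ hfam hγ₀ hrem hB hps hγ₀ hsc

/-- **K1⁸ BY NAME FROM «CEILING-KEYED RUNG 1 + MATCH-FREE BOUNDED ROWS (i)(iv)» AND DEF-1's ∀θ (C) LETTER `Cont13All`** — the ceiling-keyed analogue of DEF-1's
`K1R8RowsDefs.stabilityBRunRowsAtRecordR13SepCoPH_of_stubTexts_cont` (there: v6's registered texts + `Cont13All`).  CONDITIONAL on both hypotheses; K1⁸ NOT closed by this theorem.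
[cite: Balaban1989LargeFieldII, Thm 1 p.355; Balaban1988Convergent, Thm 1 p.262; Balaban1987RG1, Thm 3 p.264, §1 pp.263–264 (bookkeeping)] -/
theorem stabilityBRunRowsAtRecordR13SepCoPH_of_ceilingKeyedRung1WithBoundedRows_of_cont13All (hC : Cont13All)
    (h : ∀ F : T4Family, Inhabited13 F →
      ∃ (θ : Node00.Stage13HParams F 2) (h : θ.Provisos₁₃SepCoPH F 2), (θ.ZhUnity F 2 ∧ θ.SlotsNondegenerate₁₃ F 2) ∧ θ.Admissible F 2 ∧
        (∀ c : ℝ, ∃ w : WorldP, c ≤ w.βup ∧ RecordS F θ h w ∧ ∀ P : B12.RunParams, Nodes (leavesP w P)) ∧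
        ∃ (b : ℕ → ℝ) (r γ₀ B M : ℝ), 0 < γ₀ ∧ RunConstRemainder (Node00.betaOfRecord₁₃ F 2 θ.toStage13Params) b r γ₀ ∧ (∀ k, b k ≤ B) ∧
          ∀ (n : ℕ) (gs : ℕ → ℝ), RGEqH n (Node00.betaOfRecord₁₃ F 2 θ.toStage13Params) gs → Step.InInterval γ₀ n gs →
            ∀ k, k ≤ n → -M ≤ ∑ j ∈ Finset.Ico k n, Node00.betaOfRecord₁₃ F 2 θ.toStage13Params j (prefixOf gs j)) :
    Summit.QuantumFields.YangMills.Theses.BalabanUVNodes.StabilityBRunRowsAtRecordR13SepCoPH :=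
  stabilityBRunRowsAtRecordR13SepCoPH_of_rung0_runRowsCont fun F hinh => by
    obtain ⟨θ, hP, hU, hθ, hfam, b, r, γ₀, B, M, hγ₀, hrem, hB, hps⟩ := h F hinh
    exact runRowsContAt_of_ceilingKeyedRung1_of_rows_of_cont13All hC θ hP hU hθ hfam hγ₀ hrem hB hps

end Producers

end Summit.QuantumFields.YangMills.Theorems.K1R8OfCeilingKeyedRung1

end
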